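import Summits.ResolutionOfSingularities.ResolutionOfSingularities.Theorems.WeightedInvariantLocalWeightedDropWildPurePowerFlagBasic
import Summits.ResolutionOfSingularities.ResolutionOfSingularities.Theorems.WeightedInvariantLocalWeightedDropWildPurePowerFlagStatements
import Summits.ResolutionOfSingularities.ResolutionOfSingularities.Theorems.WeightedInvariantLocalWeightedDropWildPurePowerFlagStepZero
import Summits.ResolutionOfSingularities.ResolutionOfSingularities.Theorems.WeightedInvariantLocalWeightedDropWildPurePowerFlagTangent
import Literature.AlgebraicGeometry.Resolution.PointBlowupFlagShiftBound

/-!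
# `WeightedInvariant.LocalWeightedDrop`, line `hasse-ridge-face-selection`, piece S3πM: [HP24, LEMMA 2] for the game-side flag
# invariant `PurePowerFlag.dcurv` / `wFlag` (power series, first orientation)

Crux item stmt-ResolutionOfSingularities-8899 `LocalWeightedDrop` (route `ResolutionOfSingularities/WeightedInvariant`), serving the
door `WeightedConstruction` stmt-ResolutionOfSingularities-0571.  [OURS · L1 W4.3, chain w43, stub worker 2 (gen 3).  Not a statement
of any manuscript.  Printed source: H. Hauser, S. Perlega, *Resolving surface singularities in positive characteristic*, Publ. RIMS
**60** (2024), Lemma 2 p. 789: for a flag `y₁ = y + h(x)`, `n = ord h > 0`, weights `ω(x) = 1, ω(y) = n`, and the factorisation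
`in_ω(F) = x^a y^b·H`: "`d^curv_𝓕 ≤ ord H + p^{e−1}` if `pᵉ` divides `ord_ω(F)`, `d^curv_𝓕 ≤ ord H` otherwise … in the special case
`ord H = pᵉ − p^{e−1}`, the inequality `d^curv_𝓕 < pᵉ` holds."  The univariate Hasse-derivative cores
`HauserPerlega2024.exists_coeff_taylor_clean` / `exists_coeff_taylor_lt` (res-lit-5, `PointBlowupFlagTangentBound`, p495700) and the
series weight line `HauserPerlega2024.coeff_subst_triangular_of_weight_le` (`PointBlowupFlagShiftBound`, p495978) are REUSED; this
file only reads them in res-L1-w43-stub-1's game-side definitions (p504698).]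

For a CLEAN non-zero `B ∈ k[[x,y]]` (`x = X 0`, `y = X 1`), `q = pᵉ`, and a flag `h` with `ord h = n ≥ 1` (expansion
`expansion q B h = cleanSeries q (B(x, y + h(x)))`, stub-1's sign):

* the flattened weight-line polynomial `P♭ = Σ_{b ≤ w₀/n} [x^{w₀−nb} y^b]B · Y^b`, `w₀ = ord_ω B` (written out, no definition), its
  coefficients and non-vanishing (`coeff_weightLinePoly`, `weightLinePoly_ne_zero`), its cleanness (`not_dvd_of_coeff_weightLinePoly`);
* `wFlag_eq_and_dcurv_le_of_taylor` — a surviving Taylor coefficient `[Y^j] P♭(Y + t)`, `t = h_n`, with `¬(q ∣ j ∧ q ∣ w₀)` gives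
  `wFlag q B h n = w₀` and `dcurv q B h n ≤ j`;
* **`dcurv_le_ordH`** — LEMMA 2, first assertion: `dcurv ≤ (deg P♭ − tdeg P♭) + [q ∣ w₀]·p^{e−1}` (and `wFlag = w₀`);
  **`dcurv_lt_of_ordH_lt`** — the third assertion in the sharper form `deg P♭ − tdeg P♭ < q ⇒ dcurv < q`
  (`ord H = deg P♭ − tdeg P♭`: with two letters the monomials of `in_ω(B)` are `x^{w₀−nb} y^b`).
Consumers: the case-(iv) clauses of stub-1's `DropKangarooStatement` / `DropZeroStatement` (the kangaroo case needs Lemma 2 at the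
CHILD for the flag `V(x′ + g(y′))`, read on the letter swap).
-/

set_option linter.dupNamespace false -- mandated namespace of this single-conjunct summit

namespace Summit.ResolutionOfSingularities.ResolutionOfSingularities.Theorems

open Literature.AlgebraicGeometry.Resolution
open Literature.AlgebraicGeometry.Resolution.HauserPerlega2024

namespace PurePowerFlag

open MvPowerSeries

variable {k : Type} [Field k]

/-! ### The weights and the weight line -/

/-- Every monomial of `B` has `ω`-weight at least `w₀ = ord_ω B`. -/
theorem toNat_wOrder_le {n : ℕ} {B : MvPowerSeries (Fin 2) k} {d : Fin 2 →₀ ℕ} (hd : coeff d B ≠ 0) :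
    (wOrder (weights n) B).toNat ≤ d 0 + n * d 1 := by
  have h := MvPowerSeries.weightedOrder_le (w := weights n) hd
  rw [weight_weights] at h
  exact ENat.toNat_le_of_le_coe h

/-- `w₀ = ord_ω B` is attained by a monomial of `B ≠ 0`. -/
theorem exists_coeff_ne_zero_weight_eq (n : ℕ) {B : MvPowerSeries (Fin 2) k} (hB : B ≠ 0) :
    ∃ d : Fin 2 →₀ ℕ, coeff d B ≠ 0 ∧ d 0 + n * d 1 = (wOrder (weights n) B).toNat := by
  have hfin : ((wOrder (weights n) B).toNat : ℕ∞) = B.weightedOrder (weights n) :=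
    (MvPowerSeries.ne_zero_iff_weightedOrder_finite (weights n)).mp hB
  obtain ⟨d, hd, hw⟩ := MvPowerSeries.exists_coeff_ne_zero_and_weightedOrder (weights n) hfin
  refine ⟨d, hd, ?_⟩
  rw [← weight_weights]
  exact_mod_cast hw.trans hfin.symm

/-- The coefficients of the flattened weight-line polynomial `P♭ = Σ_{b ≤ w₀/n} [x^{w₀−nb} y^b]B · Y^b`. -/
theorem coeff_weightLinePoly (n w₀ : ℕ) (B : MvPowerSeries (Fin 2) k) (b : ℕ) :
    (∑ b ∈ Finset.range (w₀ / n + 1), Polynomial.monomial b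
        (coeff (Finsupp.single 0 (w₀ - n * b) + Finsupp.single 1 b) B)).coeff b =
      if b ∈ Finset.range (w₀ / n + 1) then coeff (Finsupp.single 0 (w₀ - n * b) + Finsupp.single 1 b) B else 0 := by
  classical
  rw [Polynomial.finsetSum_coeff]
  simp_rw [Polynomial.coeff_monomial]
  rw [Finset.sum_ite_eq']

/-- A non-zero coefficient of `P♭` is a monomial `x^{w₀−nb} y^b` of `B` on the weight line (`nb ≤ w₀`). -/
theorem mul_le_and_coeff_ne_zero_of_coeff_weightLinePoly {n w₀ : ℕ} {B : MvPowerSeries (Fin 2) k} {b : ℕ}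
    (hb : (∑ b ∈ Finset.range (w₀ / n + 1), Polynomial.monomial b
        (coeff (Finsupp.single 0 (w₀ - n * b) + Finsupp.single 1 b) B)).coeff b ≠ 0) :
    n * b ≤ w₀ ∧ coeff (Finsupp.single 0 (w₀ - n * b) + Finsupp.single 1 b) B ≠ 0 := by
  rw [coeff_weightLinePoly] at hb
  split_ifs at hb with hmem
  · refine ⟨?_, hb⟩
    have := Nat.lt_succ_iff.mp (Finset.mem_range.mp hmem)
    calc n * b ≤ n * (w₀ / n) := Nat.mul_le_mul_left n this
      _ ≤ w₀ := Nat.mul_div_le w₀ n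
  · exact absurd rfl hb

/-- `P♭ ≠ 0` for `B ≠ 0` (`w₀ = ord_ω B` is attained). -/
theorem weightLinePoly_ne_zero {n : ℕ} (hn : 0 < n) {B : MvPowerSeries (Fin 2) k} (hB : B ≠ 0) :
    (∑ b ∈ Finset.range ((wOrder (weights n) B).toNat / n + 1), Polynomial.monomial b
        (coeff (Finsupp.single 0 ((wOrder (weights n) B).toNat - n * b) + Finsupp.single 1 b) B)) ≠ 0 := by
  obtain ⟨d, hd, hw⟩ := exists_coeff_ne_zero_weight_eq n hB
  intro h0
  have hc := congrArg (fun P => Polynomial.coeff P (d 1)) h0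
  simp only [Polynomial.coeff_zero] at hc
  rw [coeff_weightLinePoly, if_pos (Finset.mem_range.mpr (Nat.lt_succ_iff.mpr
    ((Nat.le_div_iff_mul_le hn).mpr (by rw [mul_comm]; omega))))] at hc
  have hdeq : Finsupp.single (0 : Fin 2) ((wOrder (weights n) B).toNat - n * d 1) + Finsupp.single 1 (d 1) = d := by
    ext i
    rcases fin_two_cases i with rfl | rfl
    · rw [Finsupp.add_apply, Finsupp.single_eq_same, Finsupp.single_eq_of_ne (by decide : (0 : Fin 2) ≠ 1)]
      omega
    · rw [Finsupp.add_apply, Finsupp.single_eq_same, Finsupp.single_eq_of_ne (by decide : (1 : Fin 2) ≠ 0), zero_add]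
  rw [hdeq] at hc
  exact hd hc

/-- **`P♭` is clean**: for a clean `B`, a non-zero coefficient `[Y^b]P♭` has `¬(q ∣ b ∧ q ∣ w₀)` (else `x^{w₀−nb} y^b` would be a
`q`-th power). [HP24 Lemma 2 proof p. 790: "`F` is clean"] -/
theorem not_dvd_of_coeff_weightLinePoly {q n w₀ : ℕ} {B : MvPowerSeries (Fin 2) k} (hclean : cleanSeries q B = B)
    {b : ℕ} (hb : (∑ b ∈ Finset.range (w₀ / n + 1), Polynomial.monomial b
        (coeff (Finsupp.single 0 (w₀ - n * b) + Finsupp.single 1 b) B)).coeff b ≠ 0) : ¬ (q ∣ b ∧ q ∣ w₀) := by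
  classical
  obtain ⟨hnb, hc⟩ := mul_le_and_coeff_ne_zero_of_coeff_weightLinePoly hb
  rintro ⟨hqb, hqw⟩
  rw [← hclean, coeff_cleanSeries] at hc
  apply hc
  rw [if_pos]
  intro i
  rcases fin_two_cases i with rfl | rfl
  · rw [Finsupp.add_apply, Finsupp.single_eq_same, Finsupp.single_eq_of_ne (by decide : (0 : Fin 2) ≠ 1), add_zero]
    exact Nat.dvd_sub hqw (dvd_mul_of_dvd_right hqb n)
  · rw [Finsupp.add_apply, Finsupp.single_eq_same, Finsupp.single_eq_of_ne (by decide : (1 : Fin 2) ≠ 0), zero_add]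
    exact hqb

/-! ### From a surviving Taylor coefficient to `ord_ω` and `d^curv` of the expansion -/

/-- **A surviving monomial on the weight line.**  If `[Y^j] P♭(Y + t) ≠ 0` (`t = h_n`, `ord h = n ≥ 1`) and `¬(q ∣ j ∧ q ∣ w₀)`,
then the expansion `cleanSeries q (B(x, y + h(x)))` has `ord_ω = w₀` and its weighted initial form contains `x^{w₀−nj} y^j`, so
`d^curv ≤ j` ("`ord_{ω₁}(F₁) = ord_ω(F)` and `in_{ω₁}(F₁) = in_ω(F)(x, y₁ − t xⁿ) + G^{pᵉ}`" [HP24 p. 790]). -/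
theorem wFlag_eq_and_dcurv_le_of_taylor {q n : ℕ} (hn : 0 < n) {B : MvPowerSeries (Fin 2) k}
    {h : PowerSeries k} (hord : h.order = n) {j : ℕ}
    (hj : (Polynomial.taylor (PowerSeries.coeff n h)
      (∑ b ∈ Finset.range ((wOrder (weights n) B).toNat / n + 1), Polynomial.monomial b
        (coeff (Finsupp.single 0 ((wOrder (weights n) B).toNat - n * b) + Finsupp.single 1 b) B))).coeff j ≠ 0)
    (hjq : ¬ (q ∣ j ∧ q ∣ (wOrder (weights n) B).toNat)) :
    wFlag q B h n = (((wOrder (weights n) B).toNat : ℕ) : ℕ∞) ∧ dcurv q B h n ≤ ((j : ℕ) : ℕ∞) := by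
  classical
  set w₀ := (wOrder (weights n) B).toNat with hw₀
  set P := ∑ b ∈ Finset.range (w₀ / n + 1), Polynomial.monomial b
        (coeff (Finsupp.single 0 (w₀ - n * b) + Finsupp.single 1 b) B) with hP
  have hordn := PowerSeries.order_eq_nat.mp hord
  have hlt : ∀ m, m < n → PowerSeries.coeff m h = 0 := hordn.2
  have hw : ∀ d : Fin 2 →₀ ℕ, coeff d B ≠ 0 → w₀ ≤ d 0 + n * d 1 := fun d hd => toNat_wOrder_le hd
  have key : ∀ d : Fin 2 →₀ ℕ, d 0 + n * d 1 ≤ w₀ → coeff d (subst (shift h) B) =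
      if d 0 + n * d 1 = w₀ then (Polynomial.taylor (PowerSeries.coeff n h) P).coeff (d 1) else 0 := fun d hd =>
    coeff_subst_triangular_of_weight_le 0 1 zero_ne_one_fin fin_two_cases hn hlt rfl B hw d hd
  -- `n j ≤ w₀`
  have hnj : n * j ≤ w₀ := by
    have h1 : j ≤ P.natDegree := by
      have := Polynomial.le_natDegree_of_ne_zero hj
      rwa [Polynomial.natDegree_taylor] at this
    have h2 : P.natDegree ≤ w₀ / n :=
      Polynomial.natDegree_sum_le_of_forall_le _ _ fun b hb =>
        (Polynomial.natDegree_monomial_le _).trans (Nat.lt_succ_iff.mp (Finset.mem_range.mp hb))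
    calc n * j ≤ n * (w₀ / n) := Nat.mul_le_mul_left n (h1.trans h2)
      _ ≤ w₀ := Nat.mul_div_le w₀ n
  -- the surviving monomial
  set dj : Fin 2 →₀ ℕ := Finsupp.single 0 (w₀ - n * j) + Finsupp.single 1 j with hdj
  have hdj0 : dj 0 = w₀ - n * j := by
    rw [hdj, Finsupp.add_apply, Finsupp.single_eq_same, Finsupp.single_eq_of_ne (by decide : (0 : Fin 2) ≠ 1), add_zero]
  have hdj1 : dj 1 = j := by
    rw [hdj, Finsupp.add_apply, Finsupp.single_eq_same, Finsupp.single_eq_of_ne (by decide : (1 : Fin 2) ≠ 0), zero_add]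
  have hdjw : dj 0 + n * dj 1 = w₀ := by rw [hdj0, hdj1]; omega
  have hEdj : coeff dj (expansion q B h) ≠ 0 := by
    unfold expansion
    rw [coeff_cleanSeries, if_neg, key dj hdjw.le, if_pos hdjw, hdj1]
    · exact hj
    · intro hall
      apply hjq
      have h0 := hall 0
      have h1 := hall 1
      rw [hdj0] at h0
      rw [hdj1] at h1
      refine ⟨h1, ?_⟩
      have : w₀ = (w₀ - n * j) + n * j := by omega
      rw [this]
      exact dvd_add h0 (dvd_mul_of_dvd_right h1 n)
  have hElow : ∀ d : Fin 2 →₀ ℕ, d 0 + n * d 1 < w₀ → coeff d (expansion q B h) = 0 := by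
    intro d hd
    unfold expansion
    rw [coeff_cleanSeries]
    split_ifs
    · rfl
    · rw [key d hd.le, if_neg (Nat.ne_of_lt hd)]
  have hwo : wOrder (weights n) (expansion q B h) = ((w₀ : ℕ) : ℕ∞) := by
    rw [wOrder_eq, MvPowerSeries.weightedOrder_eq_nat]
    refine ⟨⟨dj, hEdj, by rw [weight_weights, hdjw]⟩, fun d hd => hElow d ?_⟩
    rw [weight_weights] at hd
    exact_mod_cast hd
  refine ⟨hwo, ?_⟩
  have hin : coeff dj (initialPart (weights n) (expansion q B h)) ≠ 0 := by
    rw [coeff_initialPart_ne_zero_iff]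
    exact ⟨hEdj, by rw [hwo, weight_weights, hdjw]⟩
  unfold dcurv
  exact (ordAlong_le (1 : Fin 2) hin).trans (by rw [hdj1])

variable (p : ℕ) [hp : Fact p.Prime] [CharP k p]

/-- **[HP24, LEMMA 2] for the game-side flag invariant, first assertion** (and `ord_{ω₁}(F₁) = ord_ω(F)`): for a clean non-zero
`B`, `q = pᵉ`, and a flag `h` with `ord h = n ≥ 1`: `wFlag q B h n = w₀` and
`dcurv q B h n ≤ (deg P♭ − tdeg P♭) + (p^{e−1} if q ∣ w₀ else 0)`, where `P♭` is the flattened weight-`w₀` line of `B`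
(`ord H = deg P♭ − tdeg P♭`). [HP24 Lemma 2 p. 789] -/
theorem dcurv_le_ordH {e n : ℕ} (hn : 0 < n) {B : MvPowerSeries (Fin 2) k} (hB : B ≠ 0)
    (hclean : cleanSeries (p ^ e) B = B) {h : PowerSeries k} (hord : h.order = n) :
    wFlag (p ^ e) B h n = (((wOrder (weights n) B).toNat : ℕ) : ℕ∞) ∧
      dcurv (p ^ e) B h n ≤
        (((∑ b ∈ Finset.range ((wOrder (weights n) B).toNat / n + 1), Polynomial.monomial b
            (coeff (Finsupp.single 0 ((wOrder (weights n) B).toNat - n * b) + Finsupp.single 1 b) B)).natDegree -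
          (∑ b ∈ Finset.range ((wOrder (weights n) B).toNat / n + 1), Polynomial.monomial b
            (coeff (Finsupp.single 0 ((wOrder (weights n) B).toNat - n * b) + Finsupp.single 1 b) B)).natTrailingDegree +
          (if p ^ e ∣ (wOrder (weights n) B).toNat then p ^ (e - 1) else 0) : ℕ) : ℕ∞) := by
  set w₀ := (wOrder (weights n) B).toNat with hw₀
  set P := ∑ b ∈ Finset.range (w₀ / n + 1), Polynomial.monomial b
        (coeff (Finsupp.single 0 (w₀ - n * b) + Finsupp.single 1 b) B) with hP
  have hP0 : P ≠ 0 := weightLinePoly_ne_zero hn hB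
  have ht : PowerSeries.coeff n h ≠ 0 := (PowerSeries.order_eq_nat.mp hord).1
  have hcleanP : ∀ b, P.coeff b ≠ 0 → ¬ (p ^ e ∣ b ∧ p ^ e ∣ w₀) :=
    fun b hb => not_dvd_of_coeff_weightLinePoly hclean hb
  have hβ : ∀ b, P.coeff b ≠ 0 → P.natTrailingDegree ≤ b := fun b hb => Polynomial.natTrailingDegree_le_of_ne_zero hb
  obtain ⟨j, hj, hjq, hjle, hjle'⟩ := exists_coeff_taylor_clean p hP0 ht hcleanP hβ le_rfl
  obtain ⟨hwo, hcurv⟩ := wFlag_eq_and_dcurv_le_of_taylor hn hord hj hjq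
  refine ⟨hwo, hcurv.trans ?_⟩
  split_ifs with hqw
  · exact_mod_cast hjle
  · rw [add_zero]; exact_mod_cast hjle' hqw

/-- **[HP24, LEMMA 2], third assertion** (sharper form): `deg P♭ − tdeg P♭ < q ⇒ d^curv < q`; in particular for
`ord H = pᵉ − p^{e−1}` with `e ≥ 1`. [HP24 Lemma 2 p. 789: "in the special case ord H = pᵉ − p^{e−1}, the inequality d^curv_𝓕 < pᵉ
holds"] -/
theorem dcurv_lt_of_ordH_lt {e n : ℕ} (hn : 0 < n) {B : MvPowerSeries (Fin 2) k} (hB : B ≠ 0)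
    (hclean : cleanSeries (p ^ e) B = B) {h : PowerSeries k} (hord : h.order = n)
    (hH : (∑ b ∈ Finset.range ((wOrder (weights n) B).toNat / n + 1), Polynomial.monomial b
            (coeff (Finsupp.single 0 ((wOrder (weights n) B).toNat - n * b) + Finsupp.single 1 b) B)).natDegree -
          (∑ b ∈ Finset.range ((wOrder (weights n) B).toNat / n + 1), Polynomial.monomial b
            (coeff (Finsupp.single 0 ((wOrder (weights n) B).toNat - n * b) + Finsupp.single 1 b) B)).natTrailingDegree <
        p ^ e) :
    dcurv (p ^ e) B h n < ((p ^ e : ℕ) : ℕ∞) := by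
  set w₀ := (wOrder (weights n) B).toNat with hw₀
  set P := ∑ b ∈ Finset.range (w₀ / n + 1), Polynomial.monomial b
        (coeff (Finsupp.single 0 (w₀ - n * b) + Finsupp.single 1 b) B) with hP
  have hP0 : P ≠ 0 := weightLinePoly_ne_zero hn hB
  have ht : PowerSeries.coeff n h ≠ 0 := (PowerSeries.order_eq_nat.mp hord).1
  by_cases hqw : p ^ e ∣ w₀
  · have hq' : ∀ b, P.coeff b ≠ 0 → ¬ p ^ e ∣ b :=
      fun b hb hdvd => not_dvd_of_coeff_weightLinePoly hclean hb ⟨hdvd, hqw⟩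
    obtain ⟨j, hjq, hjnd, hj⟩ := exists_coeff_taylor_lt p hP0 ht hq' hH
    obtain ⟨-, hcurv⟩ := wFlag_eq_and_dcurv_le_of_taylor hn hord hj (fun hh => hjnd hh.1)
    exact lt_of_le_of_lt hcurv (by exact_mod_cast hjq)
  · obtain ⟨-, hcurv⟩ := dcurv_le_ordH p hn hB hclean hord (e := e)
    rw [if_neg hqw, add_zero] at hcurv
    exact lt_of_le_of_lt hcurv (by exact_mod_cast hH)

end PurePowerFlag

end Summit.ResolutionOfSingularities.ResolutionOfSingularities.Theorems
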